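import Literature.NumberTheory.Automorphic.UnitaryGroupLineBorelModulus      -- ★ p842532 (this seat): `rootDeltaChar_cmBorel_torus_two` (`δ_{B₂}^{1∕2}(t) = ‖t₀₀‖^{1∕2}`)
import Literature.NumberTheory.Automorphic.CMXiTorusCharSplitTorusDecay       -- ★ `exists_map_eq_unitModulusChar_lt_one`, `quotConj_eq_one_of_map_eq`
import Literature.NumberTheory.Rogawski1990.XiLocalCharacter                  -- ★ `OneDimAutRepH`, `localDet`, `torusLocalComponent`
import HarnessLib

/-!
# (EIG) — `ξ₂ = (η_v ψ_v) ∘ det` is NOT a subrepresentation of `i(χH₂)` on `U(Φ₂)(L⁺_v)`: no non-zero `ξ₂`-eigenvector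

Cell hodgecm-mathlib (FLOOR 0), crux `H413` = `stmt-HodgeConjecture-24833`, line «CMCharIdentityTest»
(`Cruxes/H413/Lines/F0_P3b_CMCharIdentityTestPaydown.lean`, ED. 11), joint (N-H-ii′) ⟸ (JH₂) ⟸ (H3) + (H4) + (EIG) (★ junction
`F0P3bU2PrincipalSeriesJHOfBricks.uTwoPrincipalSeriesJH_of_bricks`, p842461).  THIS FILE (theorems only; no `def`, no named fact, no `sorry`) proves the
binder **(EIG)** of that junction VERBATIM: **`no_char_eigenvector_cmPrincipalSeries_two`** — for every CM `L`, finite `v` non-split in `L` and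
one-dimensional `ξ = (η, ψ)`, an `f ∈ i(χH₂)` (★ `cmPrincipalSeries L 2 v χH₂`, `χH₂ = (η̃_v‖·‖^{1∕2}, ψ_v)` the ED. 9 dictionary) with
`g·f = ξ₂(g) f` for all `g`, `ξ₂(g) = η_v(det g) ψ_v(det g)`, is ZERO.
Proof [Rogawski1990 §12.1; Casselman1995 Prop. 6.4.1 («eigenvectors of `i(χ)|_B`»)]: evaluating at `1`, `f(g) = ξ₂(g) f(1)` for all `g` (right translation ★
`toFun_smoothIndRep_apply`); on the torus element `t = d(a, a⁻¹)`, `a` a `c̄ ⊗ 1`-fixed unit of `∏_{w∣v} L_w` of module `‖a‖ < 1` (★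
`exists_map_eq_unitModulusChar_lt_one`), `det t = 1` and `a ā⁻¹ = 1`, so `ξ₂(t) = 1`, `χH₂(t) = ‖a‖^{1∕2}` while the `B`-equivariance of `f` (★
`SmoothInd.toFun_subgroup_mul`) gives `f(t) = δ_{B₂}^{1∕2}(t) χH₂(t) f(1) = ‖a‖^{1∕2}·‖a‖^{1∕2}·f(1)` (★ `rootDeltaChar_cmBorel_torus_two`); hence
`(1 − ‖a‖) f(1) = 0`, `f(1) = 0`, `f = 0`.
HONEST LABEL: HC_CM is proved only modulo the 2 remaining named inputs (hLiu418, h413) until rung 0 closes; this file closes only the binder (EIG).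

## References
* [Rogawski1990] J. D. Rogawski, *Automorphic Representations of Unitary Groups in Three Variables* (1990), §12.1 case (1) pp. 171–172.
* [Casselman1995] W. Casselman, *Introduction to the theory of admissible representations of p-adic reductive groups* (1995), Prop. 6.4.1, §3.1.
* [BernsteinZelevinsky1977] I. N. Bernstein, A. V. Zelevinsky, Ann. Sci. ÉNS 10 (1977), §2.3.
-/

set_option autoImplicit false
set_option linter.dupNamespace false

noncomputable section

open NumberField IsDedekindDomain
open scoped Matrix MatrixGroups NNReal
open Literature.NumberTheory.Rogawski1990 Literature.NumberTheory.Automorphic Literature.NumberTheory.Automorphic.UnitaryGroup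
open Literature.NumberTheory.GaloisRepresentations

namespace Summit.HodgeConjecture.HodgeConjecture.Cruxes.H413.F0P3bU2NoCharacterEigenvector

variable (L : Type) [Field L] [NumberField L] [IsCMField L]

/-- **A split-torus element `t = d(a, a⁻¹) ∈ T₂(L⁺_v)` with `‖t₀₀‖ < 1`, `t₀₀` fixed by `c̄ ⊗ 1` and `det t = 1`** (★ `exists_map_eq_unitModulusChar_lt_one`:
`a = Nm(v) ⊗ 1`; membership by ★ `glDiagonal_mem_unitaryGroupOfForm_antidiagonal_iff`). [cite: Casselman1995, §7.1 p. 67] [cite: Rogawski1990, §1.10 p. 9] -/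
theorem exists_torusU_two_norm_lt_one (v : HeightOneSpectrum (𝓞 ↥(maximalRealSubfield L))) :
    ∃ (t : ↥(torusU (conjLocal L (IsCMField.complexConj L) v) (cmLocalForm L 2 v))) (d : Fin 2 → (LocalRing L v)ˣ),
      glDiagonal 2 (LocalRing L v) d = ((t : ↥(unitaryGroupOfForm (conjLocal L (IsCMField.complexConj L) v) (cmLocalForm L 2 v))) : GL (Fin 2) (LocalRing L v)) ∧
      conjLocal L (IsCMField.complexConj L) v (d 0 : LocalRing L v) = d 0 ∧ unitModulusChar (LocalRing L v) (d 0) < 1 ∧ d 0 * d 1 = 1 := by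
  obtain ⟨a, ha, hlt⟩ := exists_map_eq_unitModulusChar_lt_one L v (conjLocal L (IsCMField.complexConj L) v)
  set d : Fin 2 → (LocalRing L v)ˣ := ![a, a⁻¹] with hd
  have hσinv : conjLocal L (IsCMField.complexConj L) v ((a⁻¹ : (LocalRing L v)ˣ) : LocalRing L v) = ((a⁻¹ : (LocalRing L v)ˣ) : LocalRing L v) := by
    have h := congrArg (conjLocal L (IsCMField.complexConj L) v) a.inv_mul
    rw [map_mul, map_one, ha] at h
    calc conjLocal L (IsCMField.complexConj L) v ((a⁻¹ : (LocalRing L v)ˣ) : LocalRing L v)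
        = conjLocal L (IsCMField.complexConj L) v ((a⁻¹ : (LocalRing L v)ˣ) : LocalRing L v) * ((a : LocalRing L v) * ((a⁻¹ : (LocalRing L v)ˣ) : LocalRing L v)) := by
          rw [a.mul_inv, mul_one]
      _ = ((a⁻¹ : (LocalRing L v)ˣ) : LocalRing L v) := by rw [← mul_assoc, h, one_mul]
  have hmem : glDiagonal 2 (LocalRing L v) d ∈ unitaryGroupOfForm (conjLocal L (IsCMField.complexConj L) v) (cmLocalForm L 2 v) := by
    rw [cmLocalForm_eq_over L 2 v, glDiagonal_mem_unitaryGroupOfForm_antidiagonal_iff]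
    intro i
    fin_cases i
    · show conjLocal L (IsCMField.complexConj L) v ((d 1 : (LocalRing L v)ˣ) : LocalRing L v) * (d 0 : LocalRing L v) = 1
      simp only [hd, Matrix.cons_val_zero, Matrix.cons_val_one]
      rw [hσinv, Units.inv_mul]
    · show conjLocal L (IsCMField.complexConj L) v ((d 0 : (LocalRing L v)ˣ) : LocalRing L v) * (d 1 : LocalRing L v) = 1
      simp only [hd, Matrix.cons_val_zero, Matrix.cons_val_one]
      rw [ha, Units.mul_inv]
  refine ⟨⟨⟨glDiagonal 2 (LocalRing L v) d, hmem⟩, ⟨d, rfl⟩⟩, d, rfl, ?_, ?_, ?_⟩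
  · simpa only [hd, Matrix.cons_val_zero] using ha
  · simpa only [hd, Matrix.cons_val_zero] using hlt
  · simp [hd]

set_option synthInstance.maxHeartbeats 400000 in  -- instance paths on the CM carrier `∏_{w ∣ v} L_w` (as ★ `isAdmissible_cmPrincipalSeriesH`)
set_option maxHeartbeats 3000000 in  -- the `cmPrincipalSeries = smoothIndRep` rfl-bridge on the CM carrier + the final `SmoothInd.ext` (measured: fails at 1.6·10⁶)
/-- **(EIG) — NO NON-ZERO `ξ₂`-EIGENVECTOR IN `i(χH₂)`** (the binder `hEig` of ★ `uTwoPrincipalSeriesJH_of_bricks`, VERBATIM): see the module docstring.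
[cite: Rogawski1990, §12.1 case (1) pp. 171–172] [cite: Casselman1995, Prop. 6.4.1] -/
theorem no_char_eigenvector_cmPrincipalSeries_two :
    ∀ (L : Type) [Field L] [NumberField L] [IsCMField L] (v : HeightOneSpectrum (𝓞 ↥(maximalRealSubfield L))) (ξ : OneDimAutRepH L),
      (∀ w : PlacesOver L v, IsCMField.complexConj L • w.1 = w.1) →
      haveI := locallyCompactSpace_cmBorelU L 2 v
      ∀ f : Representation.SmoothInd (cmBorelTriple L 2 v).P
          (Representation.twist
            (((Representation.trivial ℂ ↥(torusU (conjLocal L (IsCMField.complexConj L) v) (cmLocalForm L 2 v)) ℂ).twist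
              (torusCharPair (conjLocal L (IsCMField.complexConj L) v) (cmLocalForm L 2 v) (cmLocalForm_eq_over L 2 v) 0
                ((torusLocalComponent L (IsCMField.complexConj L) v ξ.η).comp
                    (quotConj (conjLocal L (IsCMField.complexConj L) v) (conjLocal_conjLocal_cm L v)) *
                  halfModulusChar (UnitaryGroup.LocalRing L v))
                (torusLocalComponent L (IsCMField.complexConj L) v ξ.ψ))).comp (cmBorelTriple L 2 v).proj)
            (rootDeltaChar (cmBorelTriple L 2 v).P)),
        (∀ g : ↥(unitaryGroupOfForm (conjLocal L (IsCMField.complexConj L) v) (cmLocalForm L 2 v)),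
          cmPrincipalSeries L 2 v
              (torusCharPair (conjLocal L (IsCMField.complexConj L) v) (cmLocalForm L 2 v) (cmLocalForm_eq_over L 2 v) 0
                ((torusLocalComponent L (IsCMField.complexConj L) v ξ.η).comp
                    (quotConj (conjLocal L (IsCMField.complexConj L) v) (conjLocal_conjLocal_cm L v)) *
                  halfModulusChar (UnitaryGroup.LocalRing L v))
                (torusLocalComponent L (IsCMField.complexConj L) v ξ.ψ)) g f =
            ((torusLocalComponent L (IsCMField.complexConj L) v ξ.η (localDet (IsCMField.complexConj L) v (isUnit_antidiagOne_det L 2) g) *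
                torusLocalComponent L (IsCMField.complexConj L) v ξ.ψ (localDet (IsCMField.complexConj L) v (isUnit_antidiagOne_det L 2) g) : ℂˣ) : ℂ) • f) →
        f = 0 := by
  intro L _ _ _ v ξ hns f hf
  haveI := locallyCompactSpace_cmBorelU L 2 v
  -- (★) evaluation at `1`: `f(g) = ξ₂(g) · f(1)`
  have hval : ∀ g : ↥(unitaryGroupOfForm (conjLocal L (IsCMField.complexConj L) v) (cmLocalForm L 2 v)),
      f.toFun g =
        ((torusLocalComponent L (IsCMField.complexConj L) v ξ.η (localDet (IsCMField.complexConj L) v (isUnit_antidiagOne_det L 2) g) *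
            torusLocalComponent L (IsCMField.complexConj L) v ξ.ψ (localDet (IsCMField.complexConj L) v (isUnit_antidiagOne_det L 2) g) : ℂˣ) : ℂ) *
          f.toFun 1 := by
    intro g
    have h := congrArg (fun F => Representation.SmoothInd.toFun F 1) (hf g)
    simp only [Representation.SmoothInd.toFun_smul, Pi.smul_apply, smul_eq_mul] at h
    rw [← h]
    exact (congrArg f.toFun (one_mul g)).symm
  -- the split-torus element `t = d(a, a⁻¹)`, `‖a‖ < 1`, `σ a = a`
  obtain ⟨t, d, hd, hσa, hlt, hdet⟩ := exists_torusU_two_norm_lt_one L v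
  -- `det t = 1`, as the two normed-one units of the statement
  have hdetGL : Matrix.GeneralLinearGroup.det ((t : ↥(unitaryGroupOfForm (conjLocal L (IsCMField.complexConj L) v) (cmLocalForm L 2 v))) :
      GL (Fin 2) (LocalRing L v)) = 1 := by
    rw [← hd]
    refine Units.ext ?_
    rw [Matrix.GeneralLinearGroup.val_det_apply, coe_glDiagonal, Matrix.det_diagonal, Fin.prod_univ_two, ← Units.val_mul, hdet, Units.val_one]
  have hlocalDet : localDet (IsCMField.complexConj L) v (isUnit_antidiagOne_det L 2)
      (J := Matrix.of fun i j : Fin 2 => if i.val + j.val + 1 = 2 then (1 : L) else 0)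
      (t : ↥(unitaryGroupOfForm (conjLocal L (IsCMField.complexConj L) v) (cmLocalForm L 2 v))) = 1 :=
    Subtype.ext (by rw [coe_localDet]; exact hdetGL)
  have htorusDet : torusDetNormOne (conjLocal L (IsCMField.complexConj L) v) (cmLocalForm L 2 v) (cmLocalForm_eq_over L 2 v) t = 1 := by
    refine Subtype.ext ?_
    rw [coe_torusDetNormOne, torusDet_eq_of_glDiagonal_eq _ _ t d hd, Fin.prod_univ_two, hdet]
    rfl
  have hquot : quotConj (conjLocal L (IsCMField.complexConj L) v) (conjLocal_conjLocal_cm L v) (d 0) = 1 :=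
    quotConj_eq_one_of_map_eq _ (conjLocal_conjLocal_cm L v) (d 0) hσa
  have hentry : torusEntry (conjLocal L (IsCMField.complexConj L) v) (cmLocalForm L 2 v) 0 t = d 0 :=
    torusEntry_eq_of_glDiagonal_eq _ _ 0 t d hd
  -- `f(t) = ξ₂(t) f(1) = f(1)`
  have h1 : f.toFun (t : ↥(unitaryGroupOfForm (conjLocal L (IsCMField.complexConj L) v) (cmLocalForm L 2 v))) = f.toFun 1 := by
    rw [hval, hlocalDet, map_one, map_one, mul_one, Units.val_one, one_mul]
  -- `f(t) = δ^{1/2}(t) · χH₂(t) · f(1) = ‖a‖^{1/2} · ‖a‖^{1/2} · f(1)`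
  have h2 : f.toFun (t : ↥(unitaryGroupOfForm (conjLocal L (IsCMField.complexConj L) v) (cmLocalForm L 2 v))) =
      ((NNReal.sqrt (unitModulusChar (LocalRing L v) (d 0)) : ℝ≥0) : ℂ) * (((NNReal.sqrt (unitModulusChar (LocalRing L v) (d 0)) : ℝ≥0) : ℂ) * f.toFun 1) := by
    have hp := f.toFun_subgroup_mul ⟨(t : ↥(unitaryGroupOfForm (conjLocal L (IsCMField.complexConj L) v) (cmLocalForm L 2 v))),
      torusU_le_borelU _ _ t.2⟩ 1
    have hproj : (cmBorelTriple L 2 v).proj ⟨(t : ↥(unitaryGroupOfForm (conjLocal L (IsCMField.complexConj L) v) (cmLocalForm L 2 v))),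
        torusU_le_borelU _ _ t.2⟩ = t := Subtype.ext ((cmBorelTriple L 2 v).proj_apply_of_mem_M _ t.2)
    change f.toFun ((t : ↥(unitaryGroupOfForm (conjLocal L (IsCMField.complexConj L) v) (cmLocalForm L 2 v))) * 1) = _ at hp
    rw [mul_one] at hp
    rw [hp, Representation.twist_apply, smul_eq_mul, MonoidHom.comp_apply, hproj, Representation.twist_apply, Representation.trivial_apply, smul_eq_mul, torusCharPair_apply,
      MonoidHom.mul_apply, MonoidHom.comp_apply, rootDeltaChar_cmBorel_torus_two L v t, hentry, hquot, htorusDet, map_one, map_one,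
      one_mul, mul_one, coe_halfModulusChar_apply]
  -- `(1 − ‖a‖) f(1) = 0`, `‖a‖ < 1`
  have hsq : ((NNReal.sqrt (unitModulusChar (LocalRing L v) (d 0)) : ℝ≥0) : ℂ) * ((NNReal.sqrt (unitModulusChar (LocalRing L v) (d 0)) : ℝ≥0) : ℂ) =
      ((unitModulusChar (LocalRing L v) (d 0) : ℝ≥0) : ℂ) := by
    rw [← Complex.ofReal_mul, ← NNReal.coe_mul, NNReal.mul_self_sqrt]
  have key : f.toFun 1 =
      ((NNReal.sqrt (unitModulusChar (LocalRing L v) (d 0)) : ℝ≥0) : ℂ) * (((NNReal.sqrt (unitModulusChar (LocalRing L v) (d 0)) : ℝ≥0) : ℂ) * f.toFun 1) :=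
    h1.symm.trans h2
  have h3 : (1 - ((unitModulusChar (LocalRing L v) (d 0) : ℝ≥0) : ℂ)) * f.toFun 1 = 0 := by
    linear_combination key + (f.toFun 1) * hsq
  have hf1 : f.toFun 1 = 0 := by
    rcases mul_eq_zero.1 h3 with h0 | h0
    · exfalso
      have : ((unitModulusChar (LocalRing L v) (d 0) : ℝ≥0) : ℝ) = 1 := by
        have h' := sub_eq_zero.1 h0
        exact_mod_cast h'.symm
      have hlt' : ((unitModulusChar (LocalRing L v) (d 0) : ℝ≥0) : ℝ) < 1 := by exact_mod_cast hlt
      exact absurd this (ne_of_lt hlt')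
    · exact h0
  -- `f = 0`
  refine Representation.SmoothInd.ext (funext fun g => ?_)
  rw [hval g, hf1, mul_zero]
  rfl

end Summit.HodgeConjecture.HodgeConjecture.Cruxes.H413.F0P3bU2NoCharacterEigenvector

end
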